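/- Copyright: the b2b-balaban cell (near-miss cell 7), T⁴-continuum fan-out; row NE7b ROUND-2 swarm, seat
t4-ne7b-formalise-leaf-03 (gen 5) (road W-RP, offer «W7» — journal INTENT l.17476; the junction W4c + W-E1 → W6 of
`t4/b2b-balaban-t4-ne7b-p1/LEAVES-NE7b.md` v3.54; file 1 of 2).  Released under the licence of the surrounding project. -/
import Summits.QuantumFields.BalabanUV.T4Continuum.Support.HistoryChessboardTowerRepr
import Summits.QuantumFields.BalabanUV.T4Continuum.Support.HistoryChessboardEventsCubes

/-!
# Road W-RP: THE PER-CUTOFF EVENT MODEL OF A RUN ON ITS OWN GIBBS CUBE TOWER — ten of W4b′'s clauses and E1∕E2 by name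

Summits-side support leaf of the T⁴-continuum cell (rung (B)+1 on a FINITE torus only; NOT infinite volume, NOT the
mass gap, NOT the Clay statement; NOT a proof of the spine estimate NE7b).  Row NE7b, road **W-RP** (R-OWNER-23-2 ∕
R-OWNER-23-8), offer «W7», file 1 of 2: the JUNCTION, BY NAME, of W4c's cube readings (`HistoryChessboardEventsCubes`,
leaf-06 g6, p225762: `prob`, the RP five and `Even N` PRODUCED for the `SU(n)` Gibbs towers with cube cells) with W-E1
(`HistoryChessboardTowerRepr`, leaf-01 g8, p226638: on the Gibbs tower of the data's own averagings, with `Z := Zrun` and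
`obs := obsTower`, the E1∕E2 identities FOLLOW from `repr` for term events that PARTITION the tower; `Z_pos`, `obs_meas`,
`obs_bdd` are theorems).  File 2 (`HistoryChessboardGibbs`) assembles the two runs into W6's `ChessboardRoadWitness`
(this lineage, p225502) and draws the headline (p225792).  [folklore] bookkeeping over TREE theorems; ONE hypothesis shape
(`GibbsCubeSide`, a `Prop`-valued structure like 4a's `EventSide`) and two reducible abbreviations (`cubeCount`,
`gibbsTower`); nothing printed is asserted, no `[cite:]` tag, no `Prop`-valued FACT minted (c1), no constant (c2∕c6), no
exit ∕ socket ∕ `HistoryConstants` file touched (c3).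

WHY.  W6's witness has the per-cutoff carriers `Ω K`, states `μ K`, partition functions `Z K`, observables `obs K`,
reflections and positive algebras as PARAMETERS ∕ FIELDS, and displays per run and cutoff the 21 clauses of W4b′'s
`CutoffReading` plus E1∕E2.  On road W the state of a run at cutoff `K` IS the Gibbs tower law of the data's own
averagings at `β_K = (g₀ K)⁻²` (W3l ∕ W4c ∕ W-E1), the observable IS the loop product on the top level, `Z` IS `∫ρ₀`: with
these FIXED, ten of the 21 clauses and both E1∕E2 are theorems of the tree.  This file fixes them, per run and cutoff.

WHAT.  §1 the cube format of the data's tori (`cubeCount F m₁ = 2·L^{m−m₁}` cubes of side `L^{m₁}` per direction,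
`sitesPerDir_top_eq`), the state **`gibbsTower D g₀ K := towerLaw (gibbsMeasure (F.P K) ((g₀ K)⁻¹ ^ 2)) (D.av K) K`**,
`isProbabilityMeasure_gibbsTower`, **`rp5_gibbsTower`** (the RP five at the cube cuts for (0.4)-block-averaged `SU(n)`
data — 4c's `cutoffRP_towerLaw_gibbs_SU_cubes` through W-E1's `towerLaw_congr_av`).  §2 **`structure GibbsCubeSide`**: the
per-cutoff EVENT MODEL of ONE run on ITS OWN Gibbs tower — ELEVEN clauses = `EventSide`'s fifteen MINUS `Z_pos` ∕
`obs_meas` ∕ `obs_bdd` ∕ `ob_nonneg` (theorems, W-E1) MINUS `bad_disj` PLUS the partition clause `ev_disj` (ALL term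
events pairwise disjoint — W-E1's one clause beyond `CutoffReading`; `bad_disj` follows with `bad_subset`);
`GibbsCubeSide.eventSide` (4a's shape back), **`GibbsCubeSide.cutoffReading`** (W4b′'s 21-clause reading: `prob` + the RP
five PRODUCED); §2b **`reprA_of_sides` ∕ `reprB_of_sides`** — the binders `ChessboardRoadWitness.reprA ∕ reprB` VERBATIM
from families of sides (W-E1's `reprA_of_repr` ∕ `reprB_of_repr` BY NAME).  §5 sanity: the one-term, no-pattern side is
inhabited at every cutoff (node test of the shape).

CENSUS EFFECT (honest; R-OWNER-23-8 wording for road W-RP: the printed, centred 4-d averaging prescription [B12]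
(0.3)–(0.4); (RP-ext) displayed as the covariance reading (γ)).  Over the data's OWN Gibbs cube towers the displayed list
per run and cutoff is EXACTLY the eleven clauses of `GibbsCubeSide`: (EXT) proper `repr` (that the terms of Bałaban's
𝐑-operation expansion ARE event weights of the tower — in print they carry 𝐑-operations and analytic continuations, not
bare characteristic functions), `bad_subset` ∕ `ev_meas` ∕ `E_meas`, the partition `ev_cover` + `ev_disj`, (EXT)∘(LOC)
`bad_sub`, (LOC) `loc`, (R-sym) `sym`, (U1)+(G2) `univ_le` ((B)'s content as a READING, not the pin), `r_nonneg`.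
`prob`, the RP five, `Z_pos`, `obs_meas` ∕ `obs_bdd` ∕ `ob_nonneg` and E1∕E2 are THEOREMS BY NAME; the identifications
«`blockAvg ℰ` is (0.4)» and «the run's state at cutoff `K` is the Gibbs tower law» remain READINGS (T-class).  NOTHING of
the nine discharged; the count 0∕9 is unchanged; NE7b NOT proved; spine 0∕9.  HONEST DEPENDENCY (cell): continuum YM on
T⁴ ⇐ BetaPertH ∧ nine spine estimates (0/9 proved); BetaPertH ⇐ (D1) ∧ (D4) ∧ CAP+tail; G-an2-4 gates asym, D1 and
NE2/3/4.  This file changes none of it. -/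

open Finset MeasureTheory
open Literature.Barriers.CriticalPhenomena.NonGibbs
open Literature.MathematicalPhysics.QuantumFieldTheory.LatticeRP (IsReflectionPositiveBdd)
open Literature.MathematicalPhysics.QuantumFieldTheory.Balaban1983to89
open Literature.MathematicalPhysics.QuantumFieldTheory.Balaban1983to89.Missing
open Literature.MathematicalPhysics.QuantumFieldTheory.Balaban1983to89.T4Continuum
open Summit.QuantumFields.BalabanUV.T4Continuum
open HistoryRPTowerLaw HistoryChessboardEventsCutoff HistoryChessboardEventsSplit HistoryChessboardEventsCubes
open HistoryChessboardTowerRepr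

namespace Summit.QuantumFields.BalabanUV.T4Continuum.HistoryChessboardGibbsSide

noncomputable section

/-! ## §1 The cube format of the data's tori; the Gibbs tower of a run at a cutoff; its RP five -/

section Format

variable (F : T4Family)

/-- **THE NUMBER OF CUBES OF SIDE `L^{m₁}` PER DIRECTION** of the unit lattice of every torus of the family:
`2·L^{m−m₁}` (spelled over `F.P 0` so that 4c's `even_cubeCount` ∕ `neZero_cubeCount` apply verbatim). -/
abbrev cubeCount (m₁ : ℕ) : ℕ := 2 * (F.P 0).L ^ ((F.P 0).m - m₁)

/-- `cubeCount F m₁ = 2·L^{m−m₁}` in the family's letters. [folklore] -/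
theorem cubeCount_eq (m₁ : ℕ) : cubeCount F m₁ = 2 * F.L ^ (F.m - m₁) := rfl

/-- **THE UNIT LATTICE OF THE `K`-TH TORUS IS TILED BY `cubeCount F m₁` CUBES OF SIDE `L^{m₁}` PER DIRECTION** (`m₁ ≤ m`):
4c's `sitesPerDir_cutoffParams_self_eq_mul` read on `F.P K = cutoffParams (F.P 0) K` (W-E1's `P_eq_cutoffParams`, `rfl`).
[folklore] -/
theorem sitesPerDir_top_eq {m₁ : ℕ} (hm₁ : m₁ ≤ F.m) (K : ℕ) : (F.P K).sitesPerDir K = F.L ^ m₁ * cubeCount F m₁ :=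
  sitesPerDir_cutoffParams_self_eq_mul (F.P 0) hm₁ K

variable {F} {G : Type*} [GaugeGroup G] [MeasurableSpace G] [HaarData G]

/-- **THE STATE OF A RUN AT CUTOFF `K` ON ROAD W**: the Gibbs TOWER LAW (W3l) of the data's own averagings `D.av K` over
the Wilson–Gibbs state of the `K`-th torus at `β_K = (g₀ K)⁻²` — the measure of W-E1's `reprA_of_repr`. -/
abbrev gibbsTower (D : FiniteEpsData F G) (g₀ : ℕ → ℝ) (K : ℕ) : Measure (Tower (F.P K) G K) :=
  towerLaw (T4GenFunBounds.gibbsMeasure (F.P K) ((g₀ K)⁻¹ ^ 2)) (D.av K) K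

variable [RegularGaugeGroup G]

/-- The state is a probability measure (data with measurable averaging maps). [folklore] -/
theorem isProbabilityMeasure_gibbsTower (D : FiniteEpsData F G) (hM : D.AvgMeasurable) (g₀ : ℕ → ℝ) (K : ℕ) :
    IsProbabilityMeasure (gibbsTower D g₀ K) := by
  haveI := T4GenFunBounds.isProbabilityMeasure_gibbsMeasure (G := G) (F.P K) (sq_nonneg (g₀ K)⁻¹)
  exact HistoryChessboardTowerRepr.isProbabilityMeasure_towerLaw _ (D.av K) (hM K) K

variable {n : ℕ} [NeZero n]

/-- **THE RP FIVE FOR THE DATA'S OWN GIBBS TOWER AT THE CUBE CUTS**, for (0.4)-block-averaged `SU(n)` data with a measurable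
small-loop average: sub-σ-algebras, measurable involutive measure-preserving cube-boundary reflections, reflection
positivity in the tree's bounded form — 4c's `cutoffRP_towerLaw_gibbs_SU_cubes` (W3m ∕ W3h underneath) transported along
`D.av K = blockAvg ℰ` (W-E1's `towerLaw_congr_av`).  In 4a's five-conjunct `h5` shape. [folklore] -/
theorem rp5_gibbsTower (D : FiniteEpsData F (Matrix.specialUnitaryGroup (Fin n) ℂ))
    {ℰ : LoopAverage (Matrix.specialUnitaryGroup (Fin n) ℂ)} (hBA : D.IsBlockAveraged ℰ) (hE : ℰ.MeasurableE)
    (g₀ : ℕ → ℝ) (K : ℕ) {M N : ℕ} (h : (F.P K).sitesPerDir K = M * N) :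
    (∀ (i : Fin 4) (k : ZMod N), cubePos (Matrix.specialUnitaryGroup (Fin n) ℂ) h i k ≤
        (instMeasurableSpaceTower (F.P K) (Matrix.specialUnitaryGroup (Fin n) ℂ) K :
          MeasurableSpace (Tower (F.P K) (Matrix.specialUnitaryGroup (Fin n) ℂ) K))) ∧
      (∀ (i : Fin 4) (k : ZMod N), Measurable (cubeRefl (G := Matrix.specialUnitaryGroup (Fin n) ℂ) h i k)) ∧
      (∀ (i : Fin 4) (k : ZMod N), MeasurePreserving (cubeRefl h i k) (gibbsTower D g₀ K) (gibbsTower D g₀ K)) ∧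
      (∀ (i : Fin 4) (k : ZMod N), cubeRefl (G := Matrix.specialUnitaryGroup (Fin n) ℂ) h i k ∘ cubeRefl h i k = id) ∧
      (∀ (i : Fin 4) (k : ZMod N),
        IsReflectionPositiveBdd (gibbsTower D g₀ K) (cubePos (Matrix.specialUnitaryGroup (Fin n) ℂ) h i k)
          (cubeRefl h i k)) := by
  have e : gibbsTower D g₀ K = towerLaw (T4GenFunBounds.gibbsMeasure (F.P K) ((g₀ K)⁻¹ ^ 2))
      (fun k => BlockAveraging.blockAvg (P := F.P K) (j := k) ℰ) K :=
    towerLaw_congr_av _ (fun j => by rw [hBA K j]) K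
  rw [e]
  exact cutoffRP_towerLaw_gibbs_SU_cubes (F.P K) (sq_nonneg (g₀ K)⁻¹) (fun _ => ℰ) (fun _ => hE) K
    (Nat.le_add_left K F.m) h

end Format

/-! ## §2 The per-cutoff event model of one run on its own Gibbs tower -/

section Side

variable {F : T4Family} {G : Type*} [GaugeGroup G] [MeasurableSpace G] [HaarData G] {ι Λ : Type*}

/-- **THE PER-CUTOFF EVENT MODEL OF ONE RUN ON ITS OWN GIBBS TOWER** (HYPOTHESIS SHAPE — NOTHING asserted): for the datum
`D`, the tuned run `g₀`, the loop string `os`, cubes of side `L^{m₁}` (`hm₁ : m₁ ≤ m`) and the cutoff `K` — the terms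
`T` with dressed weights `A`, the bad class `Bad`, term events `ev` and cell events `E` of the patterns `P` on the tower
`Tower (F.P K) G K`, and the per-cell rate `r`; the state is `gibbsTower D g₀ K`, the partition function `Zrun D K (g₀ K)`,
the source observable `obsTower K os` (bound `1`), the reflections ∕ positive algebras `cubeRefl` ∕ `cubePos` at the
cube cuts.  ELEVEN clauses: 4a's `EventSide` WITHOUT `Z_pos` ∕ `obs_meas` ∕ `obs_bdd` ∕ `ob_nonneg` (theorems: W-E1's
`Zrun_pos` ∕ `measurable_obsTower` ∕ `abs_obsTower_le_one`) and WITHOUT `bad_disj`, WITH the partition clause `ev_disj`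
(ALL term events pairwise disjoint; with `bad_subset` it gives `bad_disj`).  `repr` here DEFINES the weights from the
events; what it displays is (EXT) proper: that Bałaban's expansion terms ARE such weights. [folklore] -/
structure GibbsCubeSide (D : FiniteEpsData F G) (g₀ : ℕ → ℝ) (os : List (ULoop F)) {m₁ : ℕ} (hm₁ : m₁ ≤ F.m) (K : ℕ)
    (P : Finset Λ) (T : Finset ι) (A : ℝ → ι → ℝ) (Bad : Finset ι) (ev : ι → Set (Tower (F.P K) G K))
    (E : Λ → BlockIdx 4 (cubeCount F m₁) → Set (Tower (F.P K) G K)) (r : ℝ) : Prop where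
  /-- the bad class consists of terms -/
  bad_subset : Bad ⊆ T
  /-- term events are measurable -/
  ev_meas : ∀ τ ∈ T, MeasurableSet (ev τ)
  /-- cell events are measurable -/
  E_meas : ∀ l ∈ P, ∀ c, MeasurableSet (E l c)
  /-- (EXT)+(DRESS): the dressed weight of a term is `Zrun ·` the source-dressed mass of its event under the Gibbs tower -/
  repr : ∀ (t : ℝ), ∀ τ ∈ T,
    A t τ = Zrun D K (g₀ K) * ∫ ω in ev τ, Real.exp (t * obsTower K os ω) ∂gibbsTower D g₀ K
  /-- the term events exhaust the tower … -/
  ev_cover : Set.univ ⊆ ⋃ τ ∈ T, ev τ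
  /-- … and are pairwise disjoint (the partition clause) -/
  ev_disj : (↑T : Set ι).PairwiseDisjoint ev
  /-- (EXT)∘(LOC): every bad event lies inside a single-cell event of some pattern -/
  bad_sub : ∀ τ ∈ Bad, ev τ ⊆ ⋃ l ∈ P, ⋃ c : BlockIdx 4 (cubeCount F m₁), E l c
  /-- (LOC): the cell events of the positive half are measurable for the positive algebra of the cube cut -/
  loc : ∀ l ∈ P, ∀ (i : Fin 4) (k : ZMod (cubeCount F m₁)), ∀ c ∈ halfPlus (cubeCount F m₁) i k,
    MeasurableSet[cubePos G (sitesPerDir_top_eq F hm₁ K) i k] (E l c)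
  /-- (R-sym): the cell events are related by the cube-boundary reflections -/
  sym : ∀ l ∈ P, ∀ (i : Fin 4) (k : ZMod (cubeCount F m₁)) (c : BlockIdx 4 (cubeCount F m₁)),
    cubeRefl (sitesPerDir_top_eq F hm₁ K) i k ⁻¹' E l c = E l (cellReflect i k c)
  /-- (U1)+(G2), ratio currency: the universally forced pattern has probability `≤ r^(N^4)` -/
  univ_le : ∀ l ∈ P,
    (gibbsTower D g₀ K).real (⋂ c ∈ (Finset.univ : Finset (BlockIdx 4 (cubeCount F m₁))), E l c) ≤
      r ^ (cubeCount F m₁ ^ 4)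
  /-- the per-cell rate is nonnegative -/
  r_nonneg : 0 ≤ r

variable {D : FiniteEpsData F G} {g₀ : ℕ → ℝ} {os : List (ULoop F)} {m₁ : ℕ} {hm₁ : m₁ ≤ F.m} {K : ℕ}
  {P : Finset Λ} {T : Finset ι} {A : ℝ → ι → ℝ} {Bad : Finset ι} {ev : ι → Set (Tower (F.P K) G K)}
  {E : Λ → BlockIdx 4 (cubeCount F m₁) → Set (Tower (F.P K) G K)} {r : ℝ}

/-- **4a's EVENT HALF BACK, BY NAME**: the four bookkeeping clauses from W-E1 (`Zrun_pos`, `measurable_obsTower`,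
`abs_obsTower_le_one`, `ob := 1`) and `bad_disj` from the partition clause. [folklore] -/
theorem GibbsCubeSide.eventSide [RegularGaugeGroup G] (H : GibbsCubeSide D g₀ os hm₁ K P T A Bad ev E r) :
    EventSide 4 (cubeCount F m₁) P T A Bad (gibbsTower D g₀ K) (Zrun D K (g₀ K)) ev (obsTower K os) 1 E
      (cubeRefl (sitesPerDir_top_eq F hm₁ K)) (cubePos G (sitesPerDir_top_eq F hm₁ K)) r where
  Z_pos := Zrun_pos D K (g₀ K)
  bad_subset := H.bad_subset
  ev_meas := H.ev_meas
  E_meas := H.E_meas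
  obs_meas := measurable_obsTower K os
  obs_bdd := abs_obsTower_le_one K os
  ob_nonneg := zero_le_one
  repr := H.repr
  ev_cover := H.ev_cover
  bad_disj := H.ev_disj.subset (Finset.coe_subset.2 H.bad_subset)
  bad_sub := H.bad_sub
  loc := H.loc
  sym := H.sym
  univ_le := H.univ_le
  r_nonneg := H.r_nonneg

variable {n : ℕ} [NeZero n] {D : FiniteEpsData F (Matrix.specialUnitaryGroup (Fin n) ℂ)}
  {ℰ : LoopAverage (Matrix.specialUnitaryGroup (Fin n) ℂ)}
  {ev : ι → Set (Tower (F.P K) (Matrix.specialUnitaryGroup (Fin n) ℂ) K)}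
  {E : Λ → BlockIdx 4 (cubeCount F m₁) → Set (Tower (F.P K) (Matrix.specialUnitaryGroup (Fin n) ℂ) K)}

/-- **W4b′'s 21-CLAUSE READING OF THE RUN AT CUTOFF `K`, FROM THE ELEVEN**: `prob` (`isProbabilityMeasure_gibbsTower`)
and the RP five (`rp5_gibbsTower`) are PRODUCED for (0.4)-block-averaged `SU(n)` data with a measurable small-loop average;
4a's `EventSide.cutoffReading` BY NAME. [folklore] -/
theorem GibbsCubeSide.cutoffReading (hBA : D.IsBlockAveraged ℰ) (hE : ℰ.MeasurableE)
    (H : GibbsCubeSide D g₀ os hm₁ K P T A Bad ev E r) :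
    CutoffReading 4 (cubeCount F m₁) P T A Bad (gibbsTower D g₀ K) (Zrun D K (g₀ K)) ev (obsTower K os) 1 E
      (cubeRefl (sitesPerDir_top_eq F hm₁ K)) (cubePos (Matrix.specialUnitaryGroup (Fin n) ℂ) (sitesPerDir_top_eq F hm₁ K))
      r :=
  (H.eventSide).cutoffReading (isProbabilityMeasure_gibbsTower D (hBA.avgMeasurable hE) g₀ K)
    (rp5_gibbsTower D hBA hE g₀ K (sitesPerDir_top_eq F hm₁ K))

end Side

/-! ## §2b E1∕E2 from the sides, by name -/

section Repr

variable {F : T4Family} {G : Type*} [GaugeGroup G] [MeasurableSpace G] [HaarData G] [RegularGaugeGroup G] {ι Λ : Type*}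
  {D : FiniteEpsData F G} {g₀ : ℕ → ℝ} {os : List (ULoop F)} {m₁ : ℕ} {hm₁ : m₁ ≤ F.m} {P : Finset Λ}
  {T : ℕ → Finset ι} {Bad : ℕ → Finset ι} {K₀ : ℕ} {l₀ : ℝ}

/-- **E1 FOR RUN A FROM ITS SIDES** (`K`-towers at `g₀ K`): W-E1's `reprA_of_repr` on the fields `ev_meas` ∕ `ev_disj` ∕
`ev_cover` ∕ `repr` — the binder `ChessboardRoadWitness.reprA` VERBATIM (window and threshold unused). [folklore] -/
theorem reprA_of_sides (hM : D.AvgMeasurable) {A : ℕ → ℝ → ι → ℝ} {ev : ∀ K, ι → Set (Tower (F.P K) G K)}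
    {E : ∀ K, Λ → BlockIdx 4 (cubeCount F m₁) → Set (Tower (F.P K) G K)} {r : ℕ → ℝ}
    (H : ∀ K, K₀ ≤ K → GibbsCubeSide D g₀ os hm₁ K P (T K) (A K) (Bad K) (ev K) (E K) (r K)) :
    ∀ K t, |t| ≤ l₀ → K₀ ≤ K →
      ∫ U, Real.exp (t * T4GenFunBounds.prodObs (D.scheme g₀) K os U) * D.dens K (g₀ K) 0 U ∂fieldMeasure (F.P K) 0 G =
        ∑ τ ∈ T K, A K t τ :=
  reprA_of_repr D hM g₀ os (fun K hK => (H K hK).ev_meas) (fun K hK => (H K hK).ev_disj)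
    (fun K hK => (H K hK).ev_cover) (fun K hK => (H K hK).repr)

/-- **E2 FOR RUN B FROM ITS SIDES** (`(K+1)`-towers at `g₀ (K+1)`, terms indexed by `T K`): W-E1's `reprB_of_repr` — the
binder `ChessboardRoadWitness.reprB` VERBATIM. [folklore] -/
theorem reprB_of_sides (hM : D.AvgMeasurable) {A' : ℕ → ℝ → ι → ℝ} {ev' : ∀ K, ι → Set (Tower (F.P (K + 1)) G (K + 1))}
    {E' : ∀ K, Λ → BlockIdx 4 (cubeCount F m₁) → Set (Tower (F.P (K + 1)) G (K + 1))} {r' : ℕ → ℝ}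
    (H : ∀ K, K₀ ≤ K → GibbsCubeSide D g₀ os hm₁ (K + 1) P (T K) (A' K) (Bad K) (ev' K) (E' K) (r' K)) :
    ∀ K t, |t| ≤ l₀ → K₀ ≤ K →
      ∫ U, Real.exp (t * T4GenFunBounds.prodObs (D.scheme g₀) (K + 1) os U) * D.dens (K + 1) (g₀ (K + 1)) 0 U
          ∂fieldMeasure (F.P (K + 1)) 0 G = ∑ τ ∈ T K, A' K t τ :=
  reprB_of_repr D hM g₀ os (fun K hK => (H K hK).ev_meas) (fun K hK => (H K hK).ev_disj)
    (fun K hK => (H K hK).ev_cover) (fun K hK => (H K hK).repr)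

end Repr

/-! ## §3 (v1.1) The weights DEFINED by the events: the events-only reading, ten clauses -/

section Weights

variable {F : T4Family} {G : Type*} [GaugeGroup G] [MeasurableSpace G] [HaarData G] {ι Λ : Type*}

/-- **THE EVENT WEIGHT OF A TERM** (v1.1): `Zrun ·` the `e^{t·obsTower}`-dressed mass of its event under the Gibbs tower of
the run at cutoff `K` — the right member of `GibbsCubeSide.repr`, as a DEFINITION.  With `A := weight …` the clause `repr`
holds by `rfl` (`GibbsCubeEvents.side`). -/
def weight (D : FiniteEpsData F G) (g₀ : ℕ → ℝ) (os : List (ULoop F)) (K : ℕ) (ev : ι → Set (Tower (F.P K) G K))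
    (t : ℝ) (τ : ι) : ℝ :=
  Zrun D K (g₀ K) * ∫ ω in ev τ, Real.exp (t * obsTower K os ω) ∂gibbsTower D g₀ K

/-- **THE EVENTS-ONLY READING OF ONE RUN AT ONE CUTOFF** (v1.1; HYPOTHESIS SHAPE — NOTHING asserted): `GibbsCubeSide`
WITHOUT `repr` and WITHOUT the weights — TEN clauses on the term events `ev`, the cube-cell events `E` of the patterns
`P`, the bad class and the per-cell rate; INDEPENDENT of the loop string (the observable enters only the weights).  With
the weights DEFINED by `weight`, it gives `GibbsCubeSide` for every string (`GibbsCubeEvents.side`); the located content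
of road W then sits in `ev_cover` + `ev_disj` (a PARTITION of the tower), `bad_sub`, `loc` ∕ `sym`, `univ_le` — and in
NE7c ∕ NE7's bounds ON THE DEFINED WEIGHTS (file 2's `shell` ∕ `budget` at `A K := weight D g₀ os K (ev K)`). [folklore] -/
structure GibbsCubeEvents (D : FiniteEpsData F G) (g₀ : ℕ → ℝ) {m₁ : ℕ} (hm₁ : m₁ ≤ F.m) (K : ℕ) (P : Finset Λ)
    (T : Finset ι) (Bad : Finset ι) (ev : ι → Set (Tower (F.P K) G K))
    (E : Λ → BlockIdx 4 (cubeCount F m₁) → Set (Tower (F.P K) G K)) (r : ℝ) : Prop where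
  /-- the bad class consists of terms -/
  bad_subset : Bad ⊆ T
  /-- term events are measurable -/
  ev_meas : ∀ τ ∈ T, MeasurableSet (ev τ)
  /-- cell events are measurable -/
  E_meas : ∀ l ∈ P, ∀ c, MeasurableSet (E l c)
  /-- the term events exhaust the tower … -/
  ev_cover : Set.univ ⊆ ⋃ τ ∈ T, ev τ
  /-- … and are pairwise disjoint (the partition clause) -/
  ev_disj : (↑T : Set ι).PairwiseDisjoint ev
  /-- (EXT)∘(LOC): every bad event lies inside a single-cell event of some pattern -/
  bad_sub : ∀ τ ∈ Bad, ev τ ⊆ ⋃ l ∈ P, ⋃ c : BlockIdx 4 (cubeCount F m₁), E l c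
  /-- (LOC): the cell events of the positive half are measurable for the positive algebra of the cube cut -/
  loc : ∀ l ∈ P, ∀ (i : Fin 4) (k : ZMod (cubeCount F m₁)), ∀ c ∈ halfPlus (cubeCount F m₁) i k,
    MeasurableSet[cubePos G (sitesPerDir_top_eq F hm₁ K) i k] (E l c)
  /-- (R-sym): the cell events are related by the cube-boundary reflections -/
  sym : ∀ l ∈ P, ∀ (i : Fin 4) (k : ZMod (cubeCount F m₁)) (c : BlockIdx 4 (cubeCount F m₁)),
    cubeRefl (sitesPerDir_top_eq F hm₁ K) i k ⁻¹' E l c = E l (cellReflect i k c)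
  /-- (U1)+(G2), ratio currency: the universally forced pattern has probability `≤ r^(N^4)` -/
  univ_le : ∀ l ∈ P,
    (gibbsTower D g₀ K).real (⋂ c ∈ (Finset.univ : Finset (BlockIdx 4 (cubeCount F m₁))), E l c) ≤
      r ^ (cubeCount F m₁ ^ 4)
  /-- the per-cell rate is nonnegative -/
  r_nonneg : 0 ≤ r

variable {D : FiniteEpsData F G} {g₀ : ℕ → ℝ} {m₁ : ℕ} {hm₁ : m₁ ≤ F.m} {K : ℕ} {P : Finset Λ} {T : Finset ι}
  {Bad : Finset ι} {ev : ι → Set (Tower (F.P K) G K)} {E : Λ → BlockIdx 4 (cubeCount F m₁) → Set (Tower (F.P K) G K)}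
  {r : ℝ}

/-- **EVENTS + DEFINED WEIGHTS ⇒ THE ELEVEN-CLAUSE SIDE, FOR EVERY LOOP STRING** (`repr := rfl`). [folklore] -/
theorem GibbsCubeEvents.side (H : GibbsCubeEvents D g₀ hm₁ K P T Bad ev E r) (os : List (ULoop F)) :
    GibbsCubeSide D g₀ os hm₁ K P T (weight D g₀ os K ev) Bad ev E r where
  bad_subset := H.bad_subset
  ev_meas := H.ev_meas
  E_meas := H.E_meas
  repr := fun _ _ _ => rfl
  ev_cover := H.ev_cover
  ev_disj := H.ev_disj
  bad_sub := H.bad_sub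
  loc := H.loc
  sym := H.sym
  univ_le := H.univ_le
  r_nonneg := H.r_nonneg

/-- Conversely, a side FORGETS to an events-only reading (its weights are then the defined ones, by `repr`). [folklore] -/
theorem GibbsCubeSide.events {os : List (ULoop F)} {A : ℝ → ι → ℝ} (H : GibbsCubeSide D g₀ os hm₁ K P T A Bad ev E r) :
    GibbsCubeEvents D g₀ hm₁ K P T Bad ev E r where
  bad_subset := H.bad_subset
  ev_meas := H.ev_meas
  E_meas := H.E_meas
  ev_cover := H.ev_cover
  ev_disj := H.ev_disj
  bad_sub := H.bad_sub
  loc := H.loc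
  sym := H.sym
  univ_le := H.univ_le
  r_nonneg := H.r_nonneg

/-- … and a side's weights ARE the defined weights on its terms (`repr`, read as an equation of functions on `T`).
[folklore] -/
theorem GibbsCubeSide.eq_weight {os : List (ULoop F)} {A : ℝ → ι → ℝ} (H : GibbsCubeSide D g₀ os hm₁ K P T A Bad ev E r)
    (t : ℝ) {τ : ι} (hτ : τ ∈ T) : A t τ = weight D g₀ os K ev t τ :=
  H.repr t τ hτ

end Weights

/-! ## §5 Sanity: the one-term, no-pattern side is inhabited at every cutoff -/

namespace Sanity

variable {F : T4Family} {G : Type*} [GaugeGroup G] [MeasurableSpace G] [HaarData G]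

/-- The eleven clauses of `GibbsCubeSide` are JOINTLY INHABITED at every cutoff: ONE term whose event is the whole tower
and whose weight is DEFINED by `repr`, NO pattern, empty bad class, rate `0` (a node test of the SHAPE; nothing of
Bałaban's content — his terms, patterns and rates are the displayed reading). [folklore] -/
example (D : FiniteEpsData F G) (g₀ : ℕ → ℝ) (os : List (ULoop F)) {m₁ : ℕ} (hm₁ : m₁ ≤ F.m) (K : ℕ) :
    GibbsCubeSide (ι := Unit) (Λ := Unit) D g₀ os hm₁ K ∅ {()}
      (fun t _ => Zrun D K (g₀ K) * ∫ ω in (Set.univ : Set (Tower (F.P K) G K)), Real.exp (t * obsTower K os ω)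
        ∂gibbsTower D g₀ K)
      ∅ (fun _ => Set.univ) (fun _ _ => ∅) 0 where
  bad_subset := Finset.empty_subset _
  ev_meas := fun _ _ => MeasurableSet.univ
  E_meas := fun _ h => (Finset.notMem_empty _ h).elim
  repr := fun _ _ _ => rfl
  ev_cover := fun ω _ => Set.mem_iUnion₂.2 ⟨(), Finset.mem_singleton_self _, Set.mem_univ ω⟩
  ev_disj := by simp
  bad_sub := fun _ h => (Finset.notMem_empty _ h).elim
  loc := fun _ h => (Finset.notMem_empty _ h).elim
  sym := fun _ h => (Finset.notMem_empty _ h).elim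
  univ_le := fun _ h => (Finset.notMem_empty _ h).elim
  r_nonneg := le_rfl

end Sanity

end

end Summit.QuantumFields.BalabanUV.T4Continuum.HistoryChessboardGibbsSide
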